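import Summits.BirchSwinnertonDyer.BirchSwinnertonDyer.Theorems.ShaPrimaryTransferFiniteShaComponentTransferSelmerCubicKillSel
import Summits.BirchSwinnertonDyer.BirchSwinnertonDyer.Theorems.ShaPrimaryTransferFiniteShaComponentTransferSelmerCubicNodalLocal
import Summits.BirchSwinnertonDyer.BirchSwinnertonDyer.Theorems.ShaPrimaryTransferFiniteShaComponentTransferSelmerCubicNodalRep
import HarnessLib

/-!
# BirchSwinnertonDyer — SEL2CUBIC, towards the NODAL rows: the nodal sieve clause is sound on `2`-SELMER classes

HONEST FRAMING: route `ShaPrimaryTransfer`, seat `bsd-line-spt-p1` (g32), `--supports` item T =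
`FiniteShaComponentTransfer` (stmt-22356), UNCHANGED (conjecture-grade at corank ≥ 2). BSD in rank ≥ 2 is NOT
proved by any of this. THEOREMS ONLY.

Assembly of the three bricks `…SelmerCubicNodalLocal` (§1 the per-point nodal lemma for a `ℚ_ℓ`-point with
per-embedding square data; §2 per-place Selmer square data ⟹ per-embedding square data in `ℚ_ℓ`) and
`…SelmerCubicNodalRep` (a representative with `y ≠ 0`) with g30's Selmer-to-local bridge as used in
`…SelmerCubicKillSel` (`exists_resTorsion_eq_kummerMapTorsion_of_mem_selmerGroup`, `isSquare_of_resTorsion_eq`):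

* **`uvecOdd_mem_splitImgOdd_sel`** — for a `2`-Selmer class `c` of `E : y² = x³ + Ax² + Bx + C` (`E(ℚ)[2] = 0`, cubic
  `2`-division field `K = ℚ(α)`, `rank E(ℚ) ≥ 1`) with Cassels class `[a]`, a subset `U` of the family with
  `a·∏_{j∈U} w_j ∈ K^{×2}`, and a nodal certificate at an odd prime `ℓ` TOTALLY SPLIT in `K` (three embeddings
  `φ_i : K → ℚ_ℓ` with Hensel data, exactly the hypotheses of the census lemma `uvecOdd_mem_splitImgOdd`): the kernel class
  vector `uvecOdd ℓ (X_j(a_i)) U` lies in `splitImgOdd ℓ (X_t(a_i))`. This is the `extra`-clause soundness the nodal host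
  certificates (`…RealCurveCertSSQN.rank_le_of_checkRS3N`, `…CurveCertE3N`, …) need when they are read on
  `Sel⁽²⁾(E/ℚ)` instead of `E(ℚ)/2E(ℚ)`; the hosts' Selmer reading itself is NOT in this file.
[cite: Cassels1991LecturesEllipticCurves, §15] [cite: SilvermanAEC2009, Prop. X.1.4, X.§4]
-/

-- single-conjunct summit: `Summit.BirchSwinnertonDyer.BirchSwinnertonDyer.…` repeats the name by design
set_option linter.dupNamespace false
set_option autoImplicit false

noncomputable section

open scoped Classical NumberField
open Polynomial NumberField

namespace Summit.BirchSwinnertonDyer.BirchSwinnertonDyer.Theorems.ShaPrimaryTransferSelmerCubicNodal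

open Summit.BirchSwinnertonDyer.BirchSwinnertonDyer.Rank2Observatory
open Summit.BirchSwinnertonDyer.BirchSwinnertonDyer.Rank2Observatory.TwoDescCl
open Summit.BirchSwinnertonDyer.BirchSwinnertonDyer.Rank2Observatory.TwoDescCl.SplitImage
open Summit.BirchSwinnertonDyer.BirchSwinnertonDyer.Rank2Observatory.TwoDescCubic
open Summit.BirchSwinnertonDyer.BirchSwinnertonDyer.Theorems.ShaPrimaryTransferSelmerCubicCover
open Summit.BirchSwinnertonDyer.BirchSwinnertonDyer.Theorems.ShaPrimaryTransferSelmerCubicKill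
open Literature.NumberTheory.NumberFields Literature.NumberTheory.EllipticCurves
  Literature.NumberTheory.GaloisRepresentations IsDedekindDomain NumberField Module
open WeierstrassCurve WeierstrassCurve.Affine

variable {K : Type} [Field K] [NumberField K] {a b c : ℤ} {α : K} {A B C : ℤ} {ℓ : ℕ} [hp : Fact ℓ.Prime]

/-- **The nodal sieve clause is sound on `2`-Selmer classes** (odd totally split `ℓ`). See the module docstring.
[cite: Cassels1991LecturesEllipticCurves, §15] [cite: SilvermanAEC2009, Prop. X.1.4, X.§4] -/
theorem uvecOdd_mem_splitImgOdd_sel (S : SqClassMapOdd ℓ) (hℓ : ℓ ≠ 2)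
    (hα : aeval α (MonicCubic.poly a b c) = 0)
    (E : WeierstrassCurve ℚ) [E.IsElliptic] (ha₁ : E.a₁ = 0) (ha₂ : E.a₂ = A) (ha₃ : E.a₃ = 0)
    (ha₄ : E.a₄ = B) (ha₆ : E.a₆ = C) (hrank : 1 ≤ E.mordellWeilRank)
    {m : ℤ} (hm : m ≠ 0) {e : 𝓞 K} {Xt : ℤ × ℤ × ℤ}
    (he : ((m ^ 2 : ℤ) : 𝓞 K) * e = TwoDescCubic.lin hα Xt.1 Xt.2.1 Xt.2.2)
    (hroot : e ^ 3 + (A : 𝓞 K) * e ^ 2 + (B : 𝓞 K) * e + (C : 𝓞 K) = 0)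
    (hθ : aeval (algebraMap (𝓞 K) K e) (MonicCubic.poly A B C) = 0)
    [(E.baseChange K).IsElliptic]
    {cS : galH1Torsion E 2} (hcS : cS ∈ selmerGroup E 2) (aK : Kˣ)
    (haK : kummerEquiv K 2 (E.oneRootDescentH1 K (isTwoTorsionX_of_aeval E ha₁ ha₂ ha₃ ha₄ ha₆ hθ) cS) =
      Additive.ofMul (QuotientGroup.mk aK))
    {ι : Type*} [DecidableEq ι] {w : ι → 𝓞 K} {X : ι → ℤ × ℤ × ℤ}
    (hw : ∀ j, ((m ^ 2 : ℤ) : 𝓞 K) * w j = TwoDescCubic.lin hα (X j).1 (X j).2.1 (X j).2.2)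
    (hw0 : ∀ j, w j ≠ 0) {U : Finset ι}
    (hsqU : IsSquare ((aK : K) * ∏ j ∈ U, algebraMap (𝓞 K) K (w j)))
    {z : Fin 3 → ℤ_[ℓ]} {φ : Fin 3 → (K →+* ℚ_[ℓ])} (hφ : ∀ i, φ i α = (z i : ℚ_[ℓ]))
    {ar : Fin 3 → ℤ} {N : ℕ} (hclose : ∀ i, ‖z i - (ar i : ℤ_[ℓ])‖ ≤ (ℓ : ℝ) ^ (-(N : ℤ)))
    (hdist : ∀ i k : Fin 3, i ≠ k → evalInt (ar i) Xt ≠ evalInt (ar k) Xt)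
    (hdepth : nodeDepth ℓ (fun i => evalInt (ar i) Xt) + 1 ≤ N)
    (hprec : ∀ i j, evalInt (ar i) (X j) ≠ 0 ∧ valInt ℓ (evalInt (ar i) (X j)) < N) :
    uvecOdd ℓ (fun i j => evalInt (ar i) (X j)) U ∈ splitImgOdd ℓ (fun i => evalInt (ar i) Xt) := by
  -- notation
  set θE : K := algebraMap (𝓞 K) K e with hθE_def
  set ζ : K := ∏ j ∈ U, algebraMap (𝓞 K) K (w j) with hζ_def
  have hζ0 : ζ ≠ 0 := Finset.prod_ne_zero_iff.mpr fun j _ => RingOfIntegers.coe_ne_zero_iff.mpr (hw0 j)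
  -- the place `v = ℓ` of `ℚ` and a point `P ∈ E(ℚ_ℓ)` carrying the class
  set v : IsDedekindDomain.HeightOneSpectrum (𝓞 ℚ) :=
    (Rat.HeightOneSpectrum.primesEquiv (R := 𝓞 ℚ)).symm ⟨ℓ, hp.out⟩ with hv
  -- pin the `ℚ`-algebra structure of `ℚ_v` (a local instance beats `DivisionRing.toRatAlgebra`)
  letI instQv : Algebra ℚ (v.adicCompletion ℚ) := inferInstance
  haveI : (E.baseChange (v.adicCompletion ℚ)).IsElliptic := E.isElliptic_baseChange _
  obtain ⟨P, hP'⟩ : ∃ P : (E.baseChange (v.adicCompletion ℚ)).toAffine.Point,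
      resTorsion E (v.adicCompletion ℚ) 2 cS =
        kummerMapTorsion (E.baseChange (v.adicCompletion ℚ)) 2
          (E.two_zsmul_geomPoints_baseChange_surjective (v.adicCompletion ℚ)) P := by
    haveI : CharZero (NumberField.Place.Completion (K := ℚ) (Sum.inr v)) :=
      charZero_of_injective_algebraMap (algebraMap ℚ (v.adicCompletion ℚ)).injective
    haveI : (E.baseChange (NumberField.Place.Completion (K := ℚ) (Sum.inr v))).IsElliptic :=
      E.isElliptic_baseChange _
    exact E.exists_resTorsion_eq_kummerMapTorsion_of_mem_selmerGroup hcS (Sum.inr v)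
  -- a representative with `y ≠ 0`
  haveI : CharZero (v.adicCompletion ℚ) :=
    charZero_of_injective_algebraMap (algebraMap ℚ (v.adicCompletion ℚ)).injective
  obtain ⟨x, y, hxy, hy, hrep⟩ := exists_rep_y_ne_zero_kummer E ha₁ ha₃ hrank (v.adicCompletion ℚ)
    (E.two_zsmul_geomPoints_baseChange_surjective (v.adicCompletion ℚ)) P
  rw [← hrep] at hP'
  have hθEt := isTwoTorsionX_of_aeval E ha₁ ha₂ ha₃ ha₄ ha₆ hθ
  have ha' : kummerEquiv K 2 ((E.baseChange K).oneRootCharH1 hθEt (resTorsion E K 2 cS)) =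
      Additive.ofMul (QuotientGroup.mk aK) := by
    rw [← oneRootDescentH1_apply]; exact haK
  -- per-place square data at every `w ∣ ℓ`: `ζ·ρ_w² = x − θE`
  have hwq : ∀ wK : v.Extension (𝓞 K), ∃ ρw : wK.1.adicCompletion K,
      algebraMap K (wK.1.adicCompletion K) ζ * ρw ^ 2 =
        algebraMap (v.adicCompletion ℚ) (wK.1.adicCompletion K) x - algebraMap K (wK.1.adicCompletion K) θE := by
    intro wK
    haveI : CharZero (wK.1.adicCompletion K) :=
      charZero_of_injective_algebraMap (algebraMap K (wK.1.adicCompletion K)).injective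
    haveI : (E.baseChange (wK.1.adicCompletion K)).IsElliptic := E.isElliptic_baseChange _
    haveI : ((E.baseChange K).baseChange (wK.1.adicCompletion K)).IsElliptic :=
      (E.baseChange K).isElliptic_baseChange _
    haveI : ((E.baseChange (v.adicCompletion ℚ)).baseChange (wK.1.adicCompletion K)).IsElliptic :=
      (E.baseChange (v.adicCompletion ℚ)).isElliptic_baseChange _
    have key := (E.isSquare_of_resTorsion_eq (wK.1.adicCompletion K) hθEt cS aK ha' _ hP').2 hxy rfl
    obtain ⟨s, hs⟩ := key
    obtain ⟨t, ht⟩ := hsqU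
    have hA0 : algebraMap K (wK.1.adicCompletion K) (aK : K) ≠ 0 := by
      rw [map_ne_zero_iff _ (algebraMap K _).injective]; exact aK.ne_zero
    have hZ0 : algebraMap K (wK.1.adicCompletion K) ζ ≠ 0 := by
      rw [map_ne_zero_iff _ (algebraMap K _).injective]; exact hζ0
    have hAZ : algebraMap K (wK.1.adicCompletion K) (aK : K) * algebraMap K (wK.1.adicCompletion K) ζ =
        algebraMap K (wK.1.adicCompletion K) t * algebraMap K (wK.1.adicCompletion K) t := by
      rw [← map_mul, ← map_mul, ht]
    exact exists_mul_sq_eq_of_sq hA0 hZ0 hAZ hs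
  -- per-embedding square data in `ℚ_ℓ` and the transported point
  set eqv := Padic.adicCompletionEquiv (𝓞 ℚ) ⟨ℓ, hp.out⟩ with heqv
  set x' : ℚ_[ℓ] := eqv.symm x with hx'
  set y' : ℚ_[ℓ] := eqv.symm y with hy'
  have hsq : ∀ i : Fin 3,
      IsSquare ((x' - φ i (algebraMap (𝓞 K) K e)) * ∏ j ∈ U, φ i (algebraMap (𝓞 K) K (w j))) := by
    intro i
    have h := isSquare_emb_of_forall_extension ζ θE x hwq (φ i)
    rwa [hζ_def, map_prod] at h
  have hy0 : y' ≠ 0 := by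
    rw [hy']; exact (map_ne_zero_iff _ eqv.symm.injective).mpr hy
  have hcurve : y' ^ 2 = x' ^ 3 + (A : ℚ_[ℓ]) * x' ^ 2 + (B : ℚ_[ℓ]) * x' + (C : ℚ_[ℓ]) := by
    have heq := hxy.1
    rw [Affine.equation_iff] at heq
    simp only [WeierstrassCurve.baseChange, WeierstrassCurve.map_a₁, WeierstrassCurve.map_a₂,
      WeierstrassCurve.map_a₃, WeierstrassCurve.map_a₄, WeierstrassCurve.map_a₆, ha₁, ha₂, ha₃, ha₄, ha₆, map_zero,
      zero_mul, add_zero, map_intCast] at heq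
    have h := congrArg eqv.symm heq
    simp only [map_pow, map_add, map_mul, map_intCast] at h
    rw [hy', hx']
    linear_combination h
  exact uvecOdd_mem_splitImgOdd_local S hℓ hα hφ hclose hm he hroot hw hw0 hcurve hy0 hsq hdist hdepth hprec


section Two

variable [Fact (Nat.Prime 2)]

/-- **The nodal sieve clause is sound on `2`-Selmer classes at a `2`-adically totally split `2`** (`ℓ = 2`, M4a-two). See the module docstring.
[cite: Cassels1991LecturesEllipticCurves, §15] [cite: SilvermanAEC2009, Prop. X.1.4, X.§4] -/
theorem uvecTwo_mem_splitImgTwo_sel (S : SqClassMapTwo)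
    (hα : aeval α (MonicCubic.poly a b c) = 0)
    (E : WeierstrassCurve ℚ) [E.IsElliptic] (ha₁ : E.a₁ = 0) (ha₂ : E.a₂ = A) (ha₃ : E.a₃ = 0)
    (ha₄ : E.a₄ = B) (ha₆ : E.a₆ = C) (hrank : 1 ≤ E.mordellWeilRank)
    {m : ℤ} (hm : m ≠ 0) {e : 𝓞 K} {Xt : ℤ × ℤ × ℤ}
    (he : ((m ^ 2 : ℤ) : 𝓞 K) * e = TwoDescCubic.lin hα Xt.1 Xt.2.1 Xt.2.2)
    (hroot : e ^ 3 + (A : 𝓞 K) * e ^ 2 + (B : 𝓞 K) * e + (C : 𝓞 K) = 0)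
    (hθ : aeval (algebraMap (𝓞 K) K e) (MonicCubic.poly A B C) = 0)
    [(E.baseChange K).IsElliptic]
    {cS : galH1Torsion E 2} (hcS : cS ∈ selmerGroup E 2) (aK : Kˣ)
    (haK : kummerEquiv K 2 (E.oneRootDescentH1 K (isTwoTorsionX_of_aeval E ha₁ ha₂ ha₃ ha₄ ha₆ hθ) cS) =
      Additive.ofMul (QuotientGroup.mk aK))
    {ι : Type*} [DecidableEq ι] {w : ι → 𝓞 K} {X : ι → ℤ × ℤ × ℤ}
    (hw : ∀ j, ((m ^ 2 : ℤ) : 𝓞 K) * w j = TwoDescCubic.lin hα (X j).1 (X j).2.1 (X j).2.2)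
    (hw0 : ∀ j, w j ≠ 0) {U : Finset ι}
    (hsqU : IsSquare ((aK : K) * ∏ j ∈ U, algebraMap (𝓞 K) K (w j)))
    {z : Fin 3 → ℤ_[2]} {φ : Fin 3 → (K →+* ℚ_[2])} (hφ : ∀ i, φ i α = (z i : ℚ_[2]))
    {ar : Fin 3 → ℤ} {N : ℕ} (hclose : ∀ i, ‖z i - (ar i : ℤ_[2])‖ ≤ ((2 : ℕ) : ℝ) ^ (-(N : ℤ)))
    (hdist : ∀ i k : Fin 3, i ≠ k → evalInt (ar i) Xt ≠ evalInt (ar k) Xt)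
    (hdepth : nodeDepth 2 (fun i => evalInt (ar i) Xt) + 4 ≤ N)
    (hprec : ∀ i j, evalInt (ar i) (X j) ≠ 0 ∧ valInt 2 (evalInt (ar i) (X j)) + 3 ≤ N) :
    uvecTwo (fun i j => evalInt (ar i) (X j)) U ∈ splitImgTwo (fun i => evalInt (ar i) Xt) := by
  -- notation
  set θE : K := algebraMap (𝓞 K) K e with hθE_def
  set ζ : K := ∏ j ∈ U, algebraMap (𝓞 K) K (w j) with hζ_def
  have hζ0 : ζ ≠ 0 := Finset.prod_ne_zero_iff.mpr fun j _ => RingOfIntegers.coe_ne_zero_iff.mpr (hw0 j)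
  -- the place `v = ℓ` of `ℚ` and a point `P ∈ E(ℚ_ℓ)` carrying the class
  set v : IsDedekindDomain.HeightOneSpectrum (𝓞 ℚ) :=
    (Rat.HeightOneSpectrum.primesEquiv (R := 𝓞 ℚ)).symm ⟨2, Fact.out⟩ with hv
  -- pin the `ℚ`-algebra structure of `ℚ_v` (a local instance beats `DivisionRing.toRatAlgebra`)
  letI instQv : Algebra ℚ (v.adicCompletion ℚ) := inferInstance
  haveI : (E.baseChange (v.adicCompletion ℚ)).IsElliptic := E.isElliptic_baseChange _
  obtain ⟨P, hP'⟩ : ∃ P : (E.baseChange (v.adicCompletion ℚ)).toAffine.Point,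
      resTorsion E (v.adicCompletion ℚ) 2 cS =
        kummerMapTorsion (E.baseChange (v.adicCompletion ℚ)) 2
          (E.two_zsmul_geomPoints_baseChange_surjective (v.adicCompletion ℚ)) P := by
    haveI : CharZero (NumberField.Place.Completion (K := ℚ) (Sum.inr v)) :=
      charZero_of_injective_algebraMap (algebraMap ℚ (v.adicCompletion ℚ)).injective
    haveI : (E.baseChange (NumberField.Place.Completion (K := ℚ) (Sum.inr v))).IsElliptic :=
      E.isElliptic_baseChange _
    exact E.exists_resTorsion_eq_kummerMapTorsion_of_mem_selmerGroup hcS (Sum.inr v)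
  -- a representative with `y ≠ 0`
  haveI : CharZero (v.adicCompletion ℚ) :=
    charZero_of_injective_algebraMap (algebraMap ℚ (v.adicCompletion ℚ)).injective
  obtain ⟨x, y, hxy, hy, hrep⟩ := exists_rep_y_ne_zero_kummer E ha₁ ha₃ hrank (v.adicCompletion ℚ)
    (E.two_zsmul_geomPoints_baseChange_surjective (v.adicCompletion ℚ)) P
  rw [← hrep] at hP'
  have hθEt := isTwoTorsionX_of_aeval E ha₁ ha₂ ha₃ ha₄ ha₆ hθ
  have ha' : kummerEquiv K 2 ((E.baseChange K).oneRootCharH1 hθEt (resTorsion E K 2 cS)) =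
      Additive.ofMul (QuotientGroup.mk aK) := by
    rw [← oneRootDescentH1_apply]; exact haK
  -- per-place square data at every `w ∣ ℓ`: `ζ·ρ_w² = x − θE`
  have hwq : ∀ wK : v.Extension (𝓞 K), ∃ ρw : wK.1.adicCompletion K,
      algebraMap K (wK.1.adicCompletion K) ζ * ρw ^ 2 =
        algebraMap (v.adicCompletion ℚ) (wK.1.adicCompletion K) x - algebraMap K (wK.1.adicCompletion K) θE := by
    intro wK
    haveI : CharZero (wK.1.adicCompletion K) :=
      charZero_of_injective_algebraMap (algebraMap K (wK.1.adicCompletion K)).injective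
    haveI : (E.baseChange (wK.1.adicCompletion K)).IsElliptic := E.isElliptic_baseChange _
    haveI : ((E.baseChange K).baseChange (wK.1.adicCompletion K)).IsElliptic :=
      (E.baseChange K).isElliptic_baseChange _
    haveI : ((E.baseChange (v.adicCompletion ℚ)).baseChange (wK.1.adicCompletion K)).IsElliptic :=
      (E.baseChange (v.adicCompletion ℚ)).isElliptic_baseChange _
    have key := (E.isSquare_of_resTorsion_eq (wK.1.adicCompletion K) hθEt cS aK ha' _ hP').2 hxy rfl
    obtain ⟨s, hs⟩ := key
    obtain ⟨t, ht⟩ := hsqU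
    have hA0 : algebraMap K (wK.1.adicCompletion K) (aK : K) ≠ 0 := by
      rw [map_ne_zero_iff _ (algebraMap K _).injective]; exact aK.ne_zero
    have hZ0 : algebraMap K (wK.1.adicCompletion K) ζ ≠ 0 := by
      rw [map_ne_zero_iff _ (algebraMap K _).injective]; exact hζ0
    have hAZ : algebraMap K (wK.1.adicCompletion K) (aK : K) * algebraMap K (wK.1.adicCompletion K) ζ =
        algebraMap K (wK.1.adicCompletion K) t * algebraMap K (wK.1.adicCompletion K) t := by
      rw [← map_mul, ← map_mul, ht]
    exact exists_mul_sq_eq_of_sq hA0 hZ0 hAZ hs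
  -- per-embedding square data in `ℚ_ℓ` and the transported point
  set eqv := Padic.adicCompletionEquiv (𝓞 ℚ) ⟨2, Fact.out⟩ with heqv
  set x' : ℚ_[2] := eqv.symm x with hx'
  set y' : ℚ_[2] := eqv.symm y with hy'
  have hsq : ∀ i : Fin 3,
      IsSquare ((x' - φ i (algebraMap (𝓞 K) K e)) * ∏ j ∈ U, φ i (algebraMap (𝓞 K) K (w j))) := by
    intro i
    have h := isSquare_emb_of_forall_extension ζ θE x hwq (φ i)
    rwa [hζ_def, map_prod] at h
  have hy0 : y' ≠ 0 := by
    rw [hy']; exact (map_ne_zero_iff _ eqv.symm.injective).mpr hy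
  have hcurve : y' ^ 2 = x' ^ 3 + (A : ℚ_[2]) * x' ^ 2 + (B : ℚ_[2]) * x' + (C : ℚ_[2]) := by
    have heq := hxy.1
    rw [Affine.equation_iff] at heq
    simp only [WeierstrassCurve.baseChange, WeierstrassCurve.map_a₁, WeierstrassCurve.map_a₂,
      WeierstrassCurve.map_a₃, WeierstrassCurve.map_a₄, WeierstrassCurve.map_a₆, ha₁, ha₂, ha₃, ha₄, ha₆, map_zero,
      zero_mul, add_zero, map_intCast] at heq
    have h := congrArg eqv.symm heq
    simp only [map_pow, map_add, map_mul, map_intCast] at h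
    rw [hy', hx']
    linear_combination h
  exact uvecTwo_mem_splitImgTwo_local S hα hφ hclose hm he hroot hw hw0 hcurve hy0 hsq hdist hdepth hprec

end Two

end Summit.BirchSwinnertonDyer.BirchSwinnertonDyer.Theorems.ShaPrimaryTransferSelmerCubicNodal

end
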